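import Summits.Ventures.AbcSig.Recipes.EisPackage
import Summits.Ventures.AbcSig.Levels.N67

/-!
# Venture AbcSig — GENERATED module-M6 DISCHARGE certificates, level 67

HONEST FRAMING. Machine-generated by the p-lean seat's `gen/m6xgen.py` (untrusted transcription + witness search): data
from engine-1's Sturm-complete level file `N67.engine1.json` (sha256 `8e15ad601bdcddd990e44d545f88d5e5519d020ea7b2f626515e0816263b43a8`) re-expressed in the basis of the tree's
sieve data (`Levels/N67.lean`, summary `N67.json`), primes `(n, θ − r)` and Eisenstein combinations from
the cell's referee-verified M6 certificates named below. The KERNEL checks (`M6Cert.check … = true`): the Eisenstein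
congruence `a_m(f) ≡ a_m(G_λ)` for all `m ≤ B`, `6B ≥ ψ(67) = 68`; the identity `F = (X − r)·H + n·Q`; and an ordinary
sieve certificate for the data with `F` replaced by `H`. THEOREM per orbit: `M.ExcludesStd 67 orbit n` from the CITED
named hypothesis `NewformModel.EisPackage` ([BS04 (3.1), L4.2, Cor 3.1] + [Sturm 1987]) and the COMPUTED hypothesis
`NewformModel.Refines` (the extended coefficients belong to the same orbit and generator — backed by the engine file like
`DataComplete`). No claim on ABC or any summit; no Diophantine statement is made in this file.
-/

namespace Summit.Ventures.AbcSig


/-- Extended data of the tree orbit `orbit_67_2` (engine-1 id `67.2`): the same `F` and generator, entries `(p, d_p, g_p)` for EVERY prime `p ≤ 12` (`U_p`-eigenvalues from `a_bad` at `p ∣ 67`). -/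
def m6X_67_2 : OrbitData :=
  { F := [-1, 1, 1], coeffs := [⟨2, 1, [0, 1]⟩, ⟨3, 1, [1, 1]⟩, ⟨5, 1, [1, -2]⟩, ⟨7, 1, [0, -1]⟩, ⟨11, 1, [1]⟩] }

/-- M6 discharge certificate for `orbit_67_2` at `𝔫 = (11, θ − 3)` (the census certificate `M6_N67_67.2_n11_t3.json`, sha256 `0f99526205439152…`, has `r = 3` in its own basis): Eisenstein part (λ = [(67, 5)], B = 12, ψ(67) = 68), splitting `F = (X − 3)·H + 11·Q`, and the relative sieve certificate for `{F := H}` (bases [3, 5, 7], so every prime above 11 other than `𝔫` is sieved). -/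
def m6c_67_2_n11 : M6Cert :=
  { X := m6X_67_2,
    E := { n := 11, r := 3, dinv := [(2, 1), (3, 1), (5, 1), (7, 1), (11, 1)], lam := [(67, 5)], B := 12, facN := [(67, 1)], facs := [[], [(2, 1)], [(3, 1)], [(2, 2)], [(5, 1)], [(2, 1), (3, 1)], [(7, 1)], [(2, 3)], [(3, 2)], [(2, 1), (5, 1)], [(11, 1)], [(2, 2), (3, 1)]] },
    H := [4, 1], Q := [1],
    certH := { fuel := 6, trees := [.split 0 [(-4, .leaf [[-1], [1]] 1), (-2, .leaf [[1], [-1]] 1), (0, .leaf [[1], [-1]] 3), (2, .leaf [[1], [-1]] 5), (4, .leaf [[1], [-1]] 7)]], zs := [1], fac := [(3, 2), (5, 1), (7, 1)] } }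
/-- Kernel check of `m6c_67_2_n11` against `orbit_67_2`. -/
theorem m6c_67_2_n11_check : m6c_67_2_n11.check 67 orbit_67_2 = true := by
  decide +kernel
/-- **`orbit_67_2` does not give rise to the mod-11 representation of any standing datum** (module M6 in the kernel), modulo the CITED `EisPackage` and the COMPUTED `Refines 67 orbit_67_2 m6X_67_2`. -/
theorem m6c_67_2_n11_excludes (M : NewformModel) (hE : M.EisPackage) (hRef : M.Refines 67 orbit_67_2 m6X_67_2) :
    M.ExcludesStd 67 orbit_67_2 11 :=
  M.excludesStd_of_m6 hE orbit_67_2 m6c_67_2_n11 (level67_wellformed orbit_67_2 (by simp [level67Orbits])) hRef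
    m6c_67_2_n11_check

end Summit.Ventures.AbcSig
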